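import Literature.Computability.Cryptography.WordRAMStructuredBlocks
import Mathlib.Data.Nat.Bitwise
import HarnessLib

/-!
# SETH ⇒ OV (fine-grained.S09): strided word-RAM loops of the OV-instance builder

Generic verified loops (structured word-RAM code `SProg`, logic `SProg.Achieves` of
`…Cryptography.WordRAMAchieves`) used by the program of `OVFromSETHBuild.lean` /
`OVFromSETHProgram.lean`, which writes the OV instance of `OVFromSETHInstance.lean` into the memory
presented to the emulated OV algorithm (R. Williams, TCS 348 (2005), §5.1; VVW ICM 2018, Thm. 3.1):

* `OVRed.fillStride v` — write the constant `v` into `count` cells `a₀, a₀ + d, a₀ + 2d, …`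
  (registers `50` = count, `51` = address, `26` = stride); closed form `OVRed.strideSet`,
  certificate `OVRed.fillStride_spec` (`5 · count + 1` steps);
* `OVRed.scatter` — the split-and-list scatter step: for `p < count`, cell `a₀ + p d` is `and`-ed
  with the bit `(p >>> pos &&& 1) ^^^ b` (so that a clause coordinate is cleared exactly in the
  rows whose half-assignment `p` gives variable `pos` the polarity `b`); registers `50` = count,
  `51` = address, `26` = stride, `54` = pos, `46` = `b`, `56` = `p`, `52` scratch; closed form
  `OVRed.strideAnd`, certificate `OVRed.scatter_spec` (`9 · count + 1` steps).

[folklore] engineering (Nipkow–Klein, *Concrete Semantics*, §12: `WHILE` programs by invariants).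
-/

namespace Literature.Computability.FineGrained.OVRed

open Cryptography Cryptography.WordRAM Cryptography.WordRAM.SProg

/-! ### Operand shorthands -/

/-- Direct operand: register / cell `i`. [folklore] -/
abbrev r (i : ℕ) : Operand := .dir i
/-- Indirect operand through cell `i`. [folklore] -/
abbrev pt (i : ℕ) : Operand := .ind i
/-- Immediate operand. [folklore] -/
abbrev im (c : ℕ) : Operand := .imm c

/-- The block rule from a memory split as `merge m m`, the result named (as in
`CliqueRed.achieves_block_of_eq`). [folklore] -/
theorem achieves_block_of_eq {W : ℕ} {O : List ℕ → List ℕ} {ops : List OpSpec} {m : ℕ → ℕ}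
    {Q : (ℕ → ℕ) → Prop} {T : ℕ} (h : ∀ m', m' = execOps W (merge m m) ops → Q m')
    (hT : ops.length ≤ T) : Achieves W O (block ops) m Q T := by
  have := h _ rfl; rw [merge_self] at this; exact Achieves.block this hT

/-! ### Strided constant fill -/

/-- **Strided fill**: `while r50 ≠ 0 { mem[r51] := v; r51 += r26; r50 -= 1 }`. [folklore] -/
def fillStride (v : ℕ) : SProg :=
  whilenz (r 50) (block [(.band, pt 51, im v, im v), (.add, r 51, r 51, r 26), (.sub, r 50, r 50, im 1)])

/-- `fillStride` is query-free. [folklore] -/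
theorem fillStride_queryFree (v : ℕ) : (fillStride v).QueryFree := ⟨trivial, block_queryFree _⟩

/-- The memory after writing `v` into the cells `a₀ + p d`, `p < cnt`. [folklore] -/
def strideSet (m : ℕ → ℕ) (a₀ d v : ℕ) : ℕ → (ℕ → ℕ)
  | 0 => m
  | cnt + 1 => Function.update (strideSet m a₀ d v cnt) (a₀ + cnt * d) v

/-- Cells off the stride are untouched. [folklore] -/
theorem strideSet_apply_of_forall_ne {m : ℕ → ℕ} {a₀ d v a : ℕ} :
    ∀ {cnt : ℕ}, (∀ p, p < cnt → a ≠ a₀ + p * d) → strideSet m a₀ d v cnt a = m a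
  | 0, _ => rfl
  | cnt + 1, h => by
    rw [strideSet, Function.update_of_ne (h cnt (Nat.lt_succ_self _)),
      strideSet_apply_of_forall_ne fun p hp => h p (Nat.lt_succ_of_lt hp)]

/-- Cells on the stride hold `v` (for a positive stride). [folklore] -/
theorem strideSet_apply_hit {m : ℕ → ℕ} {a₀ d v : ℕ} (hd : 0 < d) :
    ∀ {cnt p : ℕ}, p < cnt → strideSet m a₀ d v cnt (a₀ + p * d) = v
  | 0, _, hp => absurd hp (Nat.not_lt_zero _)
  | cnt + 1, p, hp => by
    rw [strideSet]
    rcases Nat.lt_succ_iff_lt_or_eq.1 hp with hlt | rfl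
    · rw [Function.update_of_ne, strideSet_apply_hit hd hlt]
      intro h
      have := Nat.eq_of_mul_eq_mul_right hd (Nat.add_left_cancel h)
      omega
    · rw [Function.update_self]

/-- **The strided fill in closed form**: cell `a` holds `v` if `a = a₀ + p d` for some `p < cnt`,
and its old value otherwise. [folklore] -/
theorem strideSet_apply {m : ℕ → ℕ} {a₀ d v : ℕ} (hd : 0 < d) (cnt a : ℕ) :
    strideSet m a₀ d v cnt a =
      if a₀ ≤ a ∧ (a - a₀) % d = 0 ∧ (a - a₀) / d < cnt then v else m a := by
  split_ifs with h
  · obtain ⟨h1, h2, h3⟩ := h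
    have ha : a = a₀ + (a - a₀) / d * d := by
      have := Nat.div_add_mod (a - a₀) d
      rw [h2, Nat.add_zero] at this
      rw [Nat.mul_comm, this]; omega
    conv_lhs => rw [ha]
    exact strideSet_apply_hit hd h3
  · refine strideSet_apply_of_forall_ne fun p hp hap => h ?_
    subst hap
    refine ⟨Nat.le_add_right _ _, ?_, ?_⟩
    · rw [Nat.add_sub_cancel_left, Nat.mul_mod_left]
    · rwa [Nat.add_sub_cancel_left, Nat.mul_div_cancel _ hd]

/-- Cells below the start are untouched. [folklore] -/
theorem strideSet_apply_of_lt {m : ℕ → ℕ} {a₀ d v a : ℕ} (ha : a < a₀) (cnt : ℕ) :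
    strideSet m a₀ d v cnt a = m a :=
  strideSet_apply_of_forall_ne fun p _ h => by omega

/-- Cells at or past `a₀ + cnt · d` are untouched. [folklore] -/
theorem strideSet_apply_of_le {m : ℕ → ℕ} {a₀ d v a cnt : ℕ} (ha : a₀ + cnt * d ≤ a) (hd : 0 < d) :
    strideSet m a₀ d v cnt a = m a :=
  strideSet_apply_of_forall_ne fun p hp h => by
    subst h
    have := Nat.mul_lt_mul_of_lt_of_le hp (le_refl d) hd
    omega

section specs

variable {W : ℕ} {O : List ℕ → List ℕ}

-- The symbolic-execution `simp only` sets below are kept uniform across blocks; individual read/write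
-- lemmas are unused in some of them, hence the linter option (lint debt, as in `APSPPowerDriver`).
set_option linter.unusedSimpArgs false in
/-- **Semantics of the strided fill.** From registers `50 = cnt`, `51 = a₀`, `26 = d` (with
`a₀ ≥ 100`, the last address and the count below `2 ^ W`), `fillStride v` ends with the memory
`strideSet m a₀ d v cnt` on the data, `r50 = 0`, `r51 = a₀ + cnt · d`, every other register
unchanged, within `5 cnt + 1` steps. [folklore] -/
theorem fillStride_spec {m : ℕ → ℕ} {a₀ d v cnt : ℕ} (h50 : m 50 = cnt) (h51 : m 51 = a₀)
    (h26 : m 26 = d) (ha₀ : 100 ≤ a₀) (hfit : a₀ + cnt * d < 2 ^ W) (hcnt : cnt < 2 ^ W) :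
    Achieves W O (fillStride v) m
      (fun m' => m' 50 = 0 ∧ m' 51 = a₀ + cnt * d ∧ (∀ i, i < 100 → i ≠ 50 → i ≠ 51 → m' i = m i) ∧
        ∀ a, 100 ≤ a → m' a = strideSet m a₀ d v cnt a) (cnt * 5 + 1) := by
  refine Achieves.whilenz cnt 3
    (fun p m' => m' 50 = cnt - p ∧ m' 51 = a₀ + p * d ∧ m' 26 = d ∧
      (∀ i, i < 100 → i ≠ 50 → i ≠ 51 → m' i = m i) ∧
      ∀ a, 100 ≤ a → m' a = strideSet m a₀ d v p a)
    (fun p hp m' ⟨h1, h2, h3, h4, h5⟩ => ⟨?_, ?_⟩) (fun m' ⟨h1, _⟩ => ?_)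
    ⟨by simp [h50], by simp [h51], h26, fun i _ _ _ => rfl, fun a _ => rfl⟩
    (fun m' ⟨h1, h2, _, h4, h5⟩ => ⟨by simpa using h1, h2, h4, h5⟩) (by omega)
  · -- the test reads nonzero
    simp only [Operand.read, h1]; omega
  · -- the body
    have hpd : a₀ + p * d + d ≤ a₀ + cnt * d := by
      have : (p + 1) * d ≤ cnt * d := Nat.mul_le_mul_right _ hp
      rw [Nat.add_mul, Nat.one_mul] at this; omega
    refine achieves_block_of_eq (fun m'' hm'' => ?_) le_rfl
    simp (disch := first | omega | decide) only [execOps_cons, execOps_nil, execOp, Operand.write,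
      Operand.read, merge_apply_of_lt, merge_apply_of_le, update_merge_of_lt, update_merge_of_le,
      Function.update_self, Function.update_of_ne, BinOp.eval_add_of_lt, BinOp.eval_sub_of_le,
      BinOp.eval_band, Nat.and_self, h1, h2, h3] at hm''
    subst hm''
    refine ⟨?_, ?_, ?_, fun i hi hi50 hi51 => ?_, fun a ha => ?_⟩
    · simp (disch := first | omega | decide) only [merge_apply_of_lt, Function.update_self,
        Function.update_of_ne]; omega
    · simp (disch := first | omega | decide) only [merge_apply_of_lt, Function.update_self,
        Function.update_of_ne]; rw [Nat.succ_mul]; omega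
    · simp (disch := first | omega | decide) only [merge_apply_of_lt, Function.update_self,
        Function.update_of_ne, h3]
    · rw [merge_apply_of_lt hi]
      simp (disch := omega) only [Function.update_of_ne]
      exact h4 i hi hi50 hi51
    · rw [merge_apply_of_le ha, strideSet]
      by_cases hax : a = a₀ + p * d
      · subst hax; rw [Function.update_self, Function.update_self]
      · rw [Function.update_of_ne hax, Function.update_of_ne hax, h5 a ha]
  · -- exit
    simp only [Operand.read, h1]; omega

end specs

/-! ### The scatter step -/

/-- **Scatter**: `while r50 ≠ 0 { r52 := ((r56 >>> r54) &&& 1) ^^^ r46; mem[r51] &= r52;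
r51 += r26; r56 += 1; r50 -= 1 }`. [folklore] -/
def scatter : SProg :=
  whilenz (r 50) (block [(.shr, r 52, r 56, r 54), (.band, r 52, r 52, im 1),
    (.bxor, r 52, r 52, r 46), (.band, pt 51, pt 51, r 52), (.add, r 51, r 51, r 26),
    (.add, r 56, r 56, im 1), (.sub, r 50, r 50, im 1)])

/-- `scatter` is query-free. [folklore] -/
theorem scatter_queryFree : scatter.QueryFree := ⟨trivial, block_queryFree _⟩

/-- The scatter factor of row `p`: `0` iff bit `pos` of `p` equals `b` (the rows to clear). [folklore] -/
def scatterBit (pos : ℕ) (b : Bool) (p : ℕ) : ℕ := ((p.testBit pos) ^^ b).toNat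

/-- The memory after `and`-ing the cells `a₀ + p d`, `p < cnt`, with the scatter factors. [folklore] -/
def strideAnd (m : ℕ → ℕ) (a₀ d pos : ℕ) (b : Bool) : ℕ → (ℕ → ℕ)
  | 0 => m
  | cnt + 1 => Function.update (strideAnd m a₀ d pos b cnt) (a₀ + cnt * d)
      (strideAnd m a₀ d pos b cnt (a₀ + cnt * d) &&& scatterBit pos b cnt)

/-- Cells off the stride are untouched by the scatter. [folklore] -/
theorem strideAnd_apply_of_forall_ne {m : ℕ → ℕ} {a₀ d pos : ℕ} {b : Bool} {a : ℕ} :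
    ∀ {cnt : ℕ}, (∀ p, p < cnt → a ≠ a₀ + p * d) → strideAnd m a₀ d pos b cnt a = m a
  | 0, _ => rfl
  | cnt + 1, h => by
    rw [strideAnd, Function.update_of_ne (h cnt (Nat.lt_succ_self _)),
      strideAnd_apply_of_forall_ne fun p hp => h p (Nat.lt_succ_of_lt hp)]

/-- Cells on the stride are `and`-ed with their factor (positive stride). [folklore] -/
theorem strideAnd_apply_hit {m : ℕ → ℕ} {a₀ d pos : ℕ} {b : Bool} (hd : 0 < d) :
    ∀ {cnt p : ℕ}, p < cnt → strideAnd m a₀ d pos b cnt (a₀ + p * d) = m (a₀ + p * d) &&& scatterBit pos b p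
  | 0, _, hp => absurd hp (Nat.not_lt_zero _)
  | cnt + 1, p, hp => by
    rw [strideAnd]
    rcases Nat.lt_succ_iff_lt_or_eq.1 hp with hlt | rfl
    · rw [Function.update_of_ne, strideAnd_apply_hit hd hlt]
      intro h
      have := Nat.eq_of_mul_eq_mul_right hd (Nat.add_left_cancel h)
      omega
    · rw [Function.update_self, strideAnd_apply_of_forall_ne]
      intro q hq h
      have := Nat.eq_of_mul_eq_mul_right hd (Nat.add_left_cancel h)
      omega

/-- **The scatter in closed form.** [folklore] -/
theorem strideAnd_apply {m : ℕ → ℕ} {a₀ d pos : ℕ} {b : Bool} (hd : 0 < d) (cnt a : ℕ) :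
    strideAnd m a₀ d pos b cnt a =
      if a₀ ≤ a ∧ (a - a₀) % d = 0 ∧ (a - a₀) / d < cnt then m a &&& scatterBit pos b ((a - a₀) / d)
      else m a := by
  split_ifs with h
  · obtain ⟨h1, h2, h3⟩ := h
    have ha : a = a₀ + (a - a₀) / d * d := by
      have := Nat.div_add_mod (a - a₀) d
      rw [h2, Nat.add_zero] at this
      rw [Nat.mul_comm, this]; omega
    conv_lhs => rw [ha]
    rw [strideAnd_apply_hit hd h3, ← ha]
  · refine strideAnd_apply_of_forall_ne fun p hp hap => h ?_
    subst hap
    refine ⟨Nat.le_add_right _ _, ?_, ?_⟩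
    · rw [Nat.add_sub_cancel_left, Nat.mul_mod_left]
    · rwa [Nat.add_sub_cancel_left, Nat.mul_div_cancel _ hd]

/-- Cells below the start are untouched by the scatter. [folklore] -/
theorem strideAnd_apply_of_lt {m : ℕ → ℕ} {a₀ d pos a : ℕ} {b : Bool} (ha : a < a₀) (cnt : ℕ) :
    strideAnd m a₀ d pos b cnt a = m a :=
  strideAnd_apply_of_forall_ne fun p _ h => by omega

/-- The scatter never increases a cell. [folklore] -/
theorem strideAnd_le (m : ℕ → ℕ) (a₀ d pos : ℕ) (b : Bool) : ∀ (cnt a : ℕ),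
    strideAnd m a₀ d pos b cnt a ≤ m a
  | 0, a => le_rfl
  | cnt + 1, a => by
    rw [strideAnd]
    by_cases h : a = a₀ + cnt * d
    · subst h; rw [Function.update_self]; exact le_trans Nat.and_le_left (strideAnd_le _ _ _ _ _ cnt _)
    · rw [Function.update_of_ne h]; exact strideAnd_le _ _ _ _ _ cnt _

section specs

variable {W : ℕ} {O : List ℕ → List ℕ}

/-- The scatter factor as computed by the machine. [folklore] -/
theorem scatterBit_eq (pos : ℕ) (b : Bool) (p : ℕ) :
    ((p >>> pos) &&& 1) ^^^ b.toNat = scatterBit pos b p := by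
  have hbit : (p >>> pos) &&& 1 = (p.testBit pos).toNat := by
    rw [Nat.and_one_is_mod, Nat.shiftRight_eq_div_pow, Nat.testBit_eq_decide_div_mod_eq]
    rcases Nat.mod_two_eq_zero_or_one (p / 2 ^ pos) with h0 | h1
    · rw [h0]; simp
    · rw [h1]; simp
  rw [hbit, scatterBit]
  cases p.testBit pos <;> cases b <;> rfl

set_option linter.unusedSimpArgs false in
/-- **Semantics of the scatter.** From registers `50 = cnt`, `51 = a₀`, `26 = d`, `54 = pos`,
`46 = b`, `56 = 0` (with `a₀ ≥ 100`, addresses and cells below `2 ^ W`, `1 ≤ W`), `scatter` ends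
with the memory `strideAnd m a₀ d pos b cnt` on the data, `r50 = 0`, `r51 = a₀ + cnt · d`,
`r56 = cnt`, registers other than `50, 51, 52, 56` unchanged, within `9 cnt + 1` steps.
[folklore] -/
theorem scatter_spec {m : ℕ → ℕ} {a₀ d pos cnt : ℕ} {b : Bool} (h50 : m 50 = cnt) (h51 : m 51 = a₀)
    (h26 : m 26 = d) (h54 : m 54 = pos) (h46 : m 46 = b.toNat) (h56 : m 56 = 0) (ha₀ : 100 ≤ a₀)
    (hfit : a₀ + cnt * d < 2 ^ W) (hcnt : cnt < 2 ^ W) (hW : 1 ≤ W)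
    (hcells : ∀ a, 100 ≤ a → m a < 2 ^ W) :
    Achieves W O scatter m
      (fun m' => m' 50 = 0 ∧ m' 51 = a₀ + cnt * d ∧ m' 56 = cnt ∧
        (∀ i, i < 100 → i ≠ 50 → i ≠ 51 → i ≠ 52 → i ≠ 56 → m' i = m i) ∧
        ∀ a, 100 ≤ a → m' a = strideAnd m a₀ d pos b cnt a) (cnt * 9 + 1) := by
  have h2W : 2 ≤ 2 ^ W := by
    calc (2 : ℕ) = 2 ^ 1 := rfl
      _ ≤ 2 ^ W := Nat.pow_le_pow_right (by norm_num) hW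
  have hb1 : b.toNat ≤ 1 := Bool.toNat_le b
  refine Achieves.whilenz cnt 7
    (fun p m' => m' 50 = cnt - p ∧ m' 51 = a₀ + p * d ∧ m' 26 = d ∧ m' 54 = pos ∧
      m' 46 = b.toNat ∧ m' 56 = p ∧
      (∀ i, i < 100 → i ≠ 50 → i ≠ 51 → i ≠ 52 → i ≠ 56 → m' i = m i) ∧
      ∀ a, 100 ≤ a → m' a = strideAnd m a₀ d pos b p a)
    (fun p hp m' ⟨h1, h2, h3, h4, h5, h6, h7, h8⟩ => ⟨?_, ?_⟩) (fun m' ⟨h1, _⟩ => ?_)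
    ⟨by simp [h50], by simp [h51], h26, h54, h46, h56, fun i _ _ _ _ _ => rfl, fun a _ => rfl⟩
    (fun m' ⟨h1, h2, _, _, _, h6, h7, h8⟩ => ⟨by simpa using h1, h2, h6, h7, h8⟩) (by omega)
  · -- the test reads nonzero
    simp only [Operand.read, h1]; omega
  · -- the body
    have hpd : a₀ + p * d + d ≤ a₀ + cnt * d := by
      have : (p + 1) * d ≤ cnt * d := Nat.mul_le_mul_right _ hp
      rw [Nat.add_mul, Nat.one_mul] at this; omega
    have hbit1 : (p >>> pos) &&& 1 ≤ 1 := Nat.and_le_right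
    have hxor : ((p >>> pos) &&& 1) ^^^ b.toNat = scatterBit pos b p := scatterBit_eq pos b p
    have hsb : scatterBit pos b p ≤ 1 := Bool.toNat_le _
    have hcell : m' (a₀ + p * d) < 2 ^ W := by
      rw [h8 _ (by omega)]; exact lt_of_le_of_lt (strideAnd_le _ _ _ _ _ _ _) (hcells _ (by omega))
    refine achieves_block_of_eq (fun m'' hm'' => ?_) le_rfl
    simp (disch := first | omega | decide) only [execOps_cons, execOps_nil, execOp, Operand.write,
      Operand.read, merge_apply_of_lt, merge_apply_of_le, update_merge_of_lt, update_merge_of_le,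
      Function.update_self, Function.update_of_ne, BinOp.eval_add_of_lt, BinOp.eval_sub_of_le,
      BinOp.eval_band, BinOp.eval_shr, h1, h2, h3, h4, h5, h6] at hm''
    rw [BinOp.eval_bxor_of_lt (by omega) (by omega), hxor] at hm''
    subst hm''
    refine ⟨?_, ?_, ?_, ?_, ?_, ?_, fun i hi hi50 hi51 hi52 hi56 => ?_, fun a ha => ?_⟩
    · simp (disch := first | omega | decide) only [merge_apply_of_lt, Function.update_self,
        Function.update_of_ne]; omega
    · simp (disch := first | omega | decide) only [merge_apply_of_lt, Function.update_self,
        Function.update_of_ne]; rw [Nat.succ_mul]; omega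
    · simp (disch := first | omega | decide) only [merge_apply_of_lt, Function.update_self,
        Function.update_of_ne, h3]
    · simp (disch := first | omega | decide) only [merge_apply_of_lt, Function.update_self,
        Function.update_of_ne, h4]
    · simp (disch := first | omega | decide) only [merge_apply_of_lt, Function.update_self,
        Function.update_of_ne, h5]
    · simp (disch := first | omega | decide) only [merge_apply_of_lt, Function.update_self,
        Function.update_of_ne]
    · rw [merge_apply_of_lt hi]
      simp (disch := omega) only [Function.update_of_ne]
      exact h7 i hi hi50 hi51 hi52 hi56
    · rw [merge_apply_of_le ha, strideAnd]
      by_cases hax : a = a₀ + p * d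
      · subst hax; rw [Function.update_self, Function.update_self, h8 _ ha]
      · rw [Function.update_of_ne hax, Function.update_of_ne hax, h8 a ha]
  · -- exit
    simp only [Operand.read, h1]; omega

end specs

end Literature.Computability.FineGrained.OVRed
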